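/-
COR-CM (cell pub-hodgecm2, stage 2 of the Hodge ladder) — junction B01 `PerLFace_of_PerL`, kernel sequel of the skeleton
(`CorCM/B01/FaceSkeleton.lean`): the period as a Hodge–Riemann pairing of (2,0)-wedges on the model universe of record.
Seat prover-pub-hodgecm2-own-b01-0 (single owner of B01), 2026-08-21.  Theorems only; nothing cited beyond the tree's own
`BettiUniverse.HodgeRiemann20_holds` (Voisin I Thm. 6.32, proved in the tree); nothing asserted.
-/
import Summits.HodgeConjecture.CorCM.B01.PeriodExpansion
import Summits.HodgeConjecture.CorCM.Model.PerLConeFacts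
import Literature.AlgebraicGeometry.HodgeTheory.BettiUniverseHodgeRiemann
import HarnessLib

/-!
# B01 kernel sequel: the period is the Hodge–Riemann pairing of the (2,0)-wedges

For any universe `U`: complex conjugation is multiplicative on the complexified cup product (`conj_cup2C`), so the
quadrilinear period of PerL / rfwf is the sesquilinear pairing of the two wedges,
`∫ ω₀ ∧ ω₁ ∧ \overline{ω₂ ∧ ω₃} = tr((ω₀ ∪ ω₁) ∪ conj(ω₂ ∪ ω₃))` (`period_eq_pairing_wedges`); the wedge of two
classes of `U_Ψ(Γ) ⊆ H^{1,0}` lies in `F² H²` (`cup2C_mem_F_two_of_Uiso`, from `Fact_cup2_hodge` and `Fact_pull_hodge`).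

For the MODEL universe `Model.universeOf hHD hI hU h₃` (so for `Model.picardCMUniverse`): Hodge–Riemann in bidegree
(2,0) on every Picard modular surface is a THEOREM (`BettiUniverse.hodgeRiemann_two_zero` over the tree theorem
`HodgeRiemann20_holds`): `tr(η ∪ conj η) ≠ 0` for every non-zero `η ∈ F²H²(P_Γ)` (`Model.universeOf_hodgeRiemann_pms`).
Consequences for the displayed B01 inputs (`FaceSkeleton.lean`):
* `Model.universeOf_period_wedge_self_ne_zero` — a non-zero (12)-wedge `ω₀ ∪ ω₁` of `U_Ψ`-classes has non-zero
  "diagonal" period `∫ ω₀ ∧ ω₁ ∧ \overline{ω₀ ∧ ω₁} ≠ 0`;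
* `Model.universeOf_period_ne_zero_of_wedge_eq_smul` — COINCIDENCE COROLLARY: if at some level a (34)-pair has wedge
  `ω₂ ∪ ω₃ = c • (ω₀' ∪ ω₁')` with `c ≠ 0` and `ω₀' ∪ ω₁' ≠ 0`, the period `∫ ω₀' ∧ ω₁' ∧ \overline{ω₂ ∧ ω₃}` is
  non-zero — the cheapest sufficient condition for an instance of B01-C `FaceSeesawCoupling`.
-/

noncomputable section

open scoped TensorProduct

namespace Summit.HodgeConjecture.CorCM

open Literature.AlgebraicGeometry.Motives (CMType HodgeStructure)
open Literature.AlgebraicGeometry.Motives.HodgeStructure (EndAction conj)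

namespace Universe

variable {U : Universe}

/-- **Complex conjugation is multiplicative on the complexified cup product**: `conj (x ∪ y) = conj x ∪ conj y`
(`cup2C` is the base change of the rational cup product, `conj = conj ⊗ id`). [folklore] -/
theorem conj_cup2C (X : U.Var) (k : ℕ) (x y : U.CohC X k) :
    conj (U.cup2C X k x y) = U.cup2C X k (conj x) (conj y) := by
  induction x using TensorProduct.induction_on with
  | zero => simp
  | add a a' ha ha' => simp only [map_add, LinearMap.add_apply, ha, ha']
  | tmul z a =>
    induction y using TensorProduct.induction_on with
    | zero => simp
    | add b b' hb hb' => simp only [map_add, hb, hb']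
    | tmul w b => simp only [cup2C_tmul, HodgeStructure.conj_tmul, map_mul]

/-- **The period is the pairing of the two wedges**:
`∫ ω₀ ∧ ω₁ ∧ \overline{ω₂ ∧ ω₃} = tr((ω₀ ∪ ω₁) ∪ conj(ω₂ ∪ ω₃))`. [folklore] -/
theorem period_eq_pairing_wedges (X : U.Var) (ω : Fin 4 → U.CohC X 1) :
    U.period X ω = U.trC X 4 (U.cup2C X 2 (U.cup2C X 1 (ω 0) (ω 1)) (conj (U.cup2C X 1 (ω 2) (ω 3)))) := by
  have h : conj (U.cup2C X 1 (ω 2) (ω 3)) = U.cup2C X 1 (conj (ω 2)) (conj (ω 3)) := conj_cup2C X 1 _ _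
  show U.trC X 4 (U.cup2C X 2 (U.cup2C X 1 (ω 0) (ω 1)) (U.cup2C X 1 (conj (ω 2)) (conj (ω 3)))) = _
  exact congrArg (fun y => U.trC X 4 (U.cup2C X 2 (U.cup2C X 1 (ω 0) (ω 1)) y)) h.symm

/-- `U_Ψ(Γ) ⊆ F¹ H¹(P_Γ)` (holomorphic one-forms lie in the first step of the Hodge filtration). [folklore] -/
theorem Uiso_le_F_one (hH : U.Fact_pull_hodge) {L : CMField} {ι₁ : L →+* ℂ} {V : HermSpace3 L ι₁}
    (Γ : Level V) (K : CMField) (Ψ : CMType K) (σ : K →+* ℂ) :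
    U.Uiso Γ K Ψ σ ≤ (U.hodge (U.pms L ι₁ V Γ) 1).F 1 :=
  (Uiso_le_piece10 hH Γ K Ψ σ).trans (HodgeStructure.piece_le_F _ _ _)

/-- **The wedge of two `U_Ψ`-classes is a (2,0)-class**: `ω₀ ∪ ω₁ ∈ F² H²(P_Γ)` for `ω₀ ∈ U_{Ψ}(Γ)`, `ω₁ ∈ U_{Ψ'}(Γ)`
(`Fact_pull_hodge`, `Fact_cup2_hodge`). [folklore] -/
theorem cup2C_mem_F_two_of_Uiso (hH : U.Fact_pull_hodge) (hcup : U.Fact_cup2_hodge) {L : CMField} {ι₁ : L →+* ℂ}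
    {V : HermSpace3 L ι₁} (Γ : Level V) (K : CMField) (Ψ Ψ' : CMType K) (σ : K →+* ℂ)
    {ω₀ ω₁ : U.CohC (U.pms L ι₁ V Γ) 1} (h₀ : ω₀ ∈ U.Uiso Γ K Ψ σ) (h₁ : ω₁ ∈ U.Uiso Γ K Ψ' σ) :
    U.cup2C (U.pms L ι₁ V Γ) 1 ω₀ ω₁ ∈ (U.hodge (U.pms L ι₁ V Γ) (1 + 1)).F (1 + 1) :=
  hcup _ 1 1 1 ω₀ ω₁ (Uiso_le_F_one hH Γ K Ψ σ h₀) (Uiso_le_F_one hH Γ K Ψ' σ h₁)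

end Universe

/-! ### Hodge–Riemann on the Picard modular surfaces of the model universe -/

namespace Model

open Literature.NumberTheory.Automorphic
open Literature.NumberTheory.Automorphic.PicardCM
open Literature.AlgebraicGeometry.HodgeTheory

/-- **Hodge–Riemann in bidegree (2,0) on every Picard modular surface of the model universe** (a THEOREM of the tree:
`BettiUniverse.hodgeRiemann_two_zero` over `HodgeRiemann20_holds`; the realised surface has `dim = 2` by construction):
for `η ∈ F² H²(P_Γ)` non-zero, `tr(η ∪ conj η) ≠ 0`. [folklore] -/
theorem universeOf_hodgeRiemann_pms (hHD : exists_isReal_hodgeModel) (hI : hodgePQ_independent_of_hodgeModel)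
    (hU : BallQuotientUniformisedDatum) (h₃ : CMAbelianVarietyRealised) {L : CMField} {ι₁ : L →+* ℂ}
    (V : HermSpace3 L ι₁) (Γ : Level V)
    (η : (universeOf hHD hI hU h₃).CohC ((universeOf hHD hI hU h₃).pms L ι₁ V Γ) 2)
    (hη : η ∈ ((universeOf hHD hI hU h₃).hodge ((universeOf hHD hI hU h₃).pms L ι₁ V Γ) 2).F 2) (h0 : η ≠ 0) :
    (universeOf hHD hI hU h₃).trC ((universeOf hHD hI hU h₃).pms L ι₁ V Γ) 4
      ((universeOf hHD hI hU h₃).cup2C ((universeOf hHD hI hU h₃).pms L ι₁ V Γ) 2 η (conj η)) ≠ 0 :=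
  BettiUniverse.hodgeRiemann_two_zero hHD BettiUniverse.HodgeRiemann20_holds
    (Var.isSmoothProjective hU h₃ (.pms (pmsCode L ι₁ V Γ))) rfl η hη h0

/-- **Diagonal periods of non-zero wedges are non-zero** on the model universe: for `ω₀ ∈ U_Ψ(Γ)`, `ω₁ ∈ U_{Ψ'}(Γ)`
with `ω₀ ∪ ω₁ ≠ 0`, `∫ ω₀ ∧ ω₁ ∧ \overline{ω₀ ∧ ω₁} ≠ 0` (Hodge–Riemann). [folklore] -/
theorem universeOf_period_wedge_self_ne_zero (hHD : exists_isReal_hodgeModel) (hI : hodgePQ_independent_of_hodgeModel)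
    (hU : BallQuotientUniformisedDatum) (h₃ : CMAbelianVarietyRealised) {L : CMField} {ι₁ : L →+* ℂ}
    (V : HermSpace3 L ι₁) (Γ : Level V) (K : CMField) (Ψ Ψ' : CMType K) (σ : K →+* ℂ)
    {ω₀ ω₁ : (universeOf hHD hI hU h₃).CohC ((universeOf hHD hI hU h₃).pms L ι₁ V Γ) 1}
    (h₀ : ω₀ ∈ (universeOf hHD hI hU h₃).Uiso Γ K Ψ σ) (h₁ : ω₁ ∈ (universeOf hHD hI hU h₃).Uiso Γ K Ψ' σ)
    (hne : (universeOf hHD hI hU h₃).cup2C ((universeOf hHD hI hU h₃).pms L ι₁ V Γ) 1 ω₀ ω₁ ≠ 0) :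
    (universeOf hHD hI hU h₃).period ((universeOf hHD hI hU h₃).pms L ι₁ V Γ) ![ω₀, ω₁, ω₀, ω₁] ≠ 0 := by
  rw [Universe.period_eq_pairing_wedges]
  exact universeOf_hodgeRiemann_pms hHD hI hU h₃ V Γ _
    (Universe.cup2C_mem_F_two_of_Uiso (universeOf_fact_pull_hodge hHD hI hU h₃)
      (universeOf_fact_cup2_hodge hHD hI hU h₃) Γ K Ψ Ψ' σ h₀ h₁) hne

/-- **Coincidence corollary** (the cheapest sufficient condition for an instance of B01-C `FaceSeesawCoupling`): on
the model universe, if the (34)-wedge is a non-zero multiple of a non-zero (12)-wedge of `U_Ψ`-classes,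
`ω₂ ∪ ω₃ = c • (ω₀ ∪ ω₁)`, then `∫ ω₀ ∧ ω₁ ∧ \overline{ω₂ ∧ ω₃} = conj(c) · ∫ ω₀ ∧ ω₁ ∧ \overline{ω₀ ∧ ω₁} ≠ 0`.
[folklore] -/
theorem universeOf_period_ne_zero_of_wedge_eq_smul (hHD : exists_isReal_hodgeModel) (hI : hodgePQ_independent_of_hodgeModel)
    (hU : BallQuotientUniformisedDatum) (h₃ : CMAbelianVarietyRealised)
    {L : CMField} {ι₁ : L →+* ℂ} (V : HermSpace3 L ι₁)
    (Γ : Level V) (K : CMField) (Ψ Ψ' : CMType K) (σ : K →+* ℂ)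
    {ω₀ ω₁ ω₂ ω₃ : (universeOf hHD hI hU h₃).CohC ((universeOf hHD hI hU h₃).pms L ι₁ V Γ) 1}
    (h₀ : ω₀ ∈ (universeOf hHD hI hU h₃).Uiso Γ K Ψ σ) (h₁ : ω₁ ∈ (universeOf hHD hI hU h₃).Uiso Γ K Ψ' σ)
    (hne : (universeOf hHD hI hU h₃).cup2C ((universeOf hHD hI hU h₃).pms L ι₁ V Γ) 1 ω₀ ω₁ ≠ 0)
    {c : ℂ} (hc : c ≠ 0)
    (hw : (universeOf hHD hI hU h₃).cup2C ((universeOf hHD hI hU h₃).pms L ι₁ V Γ) 1 ω₂ ω₃ =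
      c • (universeOf hHD hI hU h₃).cup2C ((universeOf hHD hI hU h₃).pms L ι₁ V Γ) 1 ω₀ ω₁) :
    (universeOf hHD hI hU h₃).period ((universeOf hHD hI hU h₃).pms L ι₁ V Γ) ![ω₀, ω₁, ω₂, ω₃] ≠ 0 := by
  have hdiag := universeOf_period_wedge_self_ne_zero hHD hI hU h₃ V Γ K Ψ Ψ' σ h₀ h₁ hne
  rw [Universe.period_eq_pairing_wedges] at hdiag ⊢
  simp only [Matrix.cons_val_zero, Matrix.cons_val_one, Matrix.cons_val] at hdiag ⊢
  rw [hw, HodgeStructure.conj_smul, map_smul, map_smul, smul_eq_mul]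
  exact mul_ne_zero ((map_ne_zero _).2 hc) hdiag

end Model

end Summit.HodgeConjecture.CorCM

end
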